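import Mathlib

/-!
# King 1986, Lemma 4.4 (4.29) and the one-coordinate rate (4.25): the `L^{-k}` rate of the averaging weight
# `u_k^η(p)` of (4.3) — the "replace factor by factor" ingredient of Proposition 3.8

**Citation header (reproduction of PUBLISHED work; template file of the Bałaban lattice Yang–Mills cell `pub-balaban`,
TEMPLATE.md §18.2 row K3; companion of the `King1986/*` modules).**
C. King, *The U(1) Higgs model. I. The continuum limit*, Commun. Math. Phys. **102** (1986) 649–677 [King1986], §4
p. 670 (4.3) and p. 673: (4.25), Lemma 4.4 (4.29) with its proof (4.30).  Page images read: cell folder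
`b2b-balaban-template/king-renders/1986-cmp102-king-u1-higgs-I-p022-x2.png` (p. 670), `…-p025-x2.png` (p. 673).  King's
paper is TEMPLATE LITERATURE for the cell (a printed and proved `A = 0` mechanism), not a manuscript under audit.

**What King prints (verbatim).**  p. 670: *"u_k^η(p) = Π_{μ=1}^d [(e^{−ip_μ} − 1)η(e^{−iηp_μ} − 1)^{−1}], (4.3)"*
(`η = L^{−k}`; in (4.2) `p = p′ + l`, `p′ ∈ [−π, π)`, `l ∈ 2πZ^d`, `|l_μ| ≤ π(L^k − 1)` for `L` odd).  p. 673: *"Next, we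
have  |(η′)^{−1}[exp[iη′(p′+l)_μ] − 1] − η^{−1}[exp[iη(p′+l)_μ] − 1]| ≤ (η′)^{−1}sin²½η′(p′+l)_μ + η^{−1}sin²½η(p′+l)_μ
+ |(η′)^{−1}sin η′(p′+l)_μ − η^{−1}sin η(p′+l)_μ| ≤ C|p′+l|²L^{−k} ≤ C|p′+l|^{1+γ}L^{−γk}. (4.25)"* … *"**Lemma 4.4.**
|u_k^η(p′+l) − u_{k+n}^{η′}(p′+l)| ≤ CL^{−γk}|p′+l|^γ|u_k^η(p′+l)|. (4.29)  Proof.  u_{k+n}^{η′}(p′+l) − u_k^η(p′+l) =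
u_k^η(p′+l) Π_{μ=1}^d[η′(e^{−iη′(p′+l)_μ} − 1)^{−1}]·[Π_{μ=1}^d η^{−1}(e^{−iη(p′+l)_μ} − 1) − Π_{μ=1}^d (η′)^{−1}
(e^{−iη′(p′+l)_μ} − 1)]. (4.30)  By repeated use of the identity xy − zw = 1/2(x − y)(z + w) + 1/2(x + y)(z − w), we can
write the difference inside the last bracket of (4.30) as a sum of 2^{d−1} terms. Each term is a product of d factors,
at least one of which is the left-hand side of (4.25). So inserting the appropriate bounds, we get  |(4.30)| ≤
C|u_k^η(p′+l)| Π_{μ=1}^d |(p′+l)_μ|^{−1}L^{−γk} Σ_{ν=1}^d |(p′+l)_ν|^{1+γ} Π_{μ′≠ν} |(p′+l)_{μ′}| ≤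
CL^{−γk}|p′+l|^γ|u_k^η(p′+l)|,  as required.  Therefore we can replace u_{k+n}^{η′}(p′+l) by u_k^η(p′+l) and bound the
error."*

**What this file PROVES (kernel, Mathlib only; explicit constants; the `γ = 1` form).**
* §1 `fdq η q = η⁻¹(e^{−iηq} − 1)` (one coordinate of the denominator of (4.3)); `‖fdq η q‖ ≤ |q|` (`norm_fdq_le`),
  `‖fdq η q‖ ≥ (2/π)|q|` on the zone `|ηq| ≤ π` (`norm_fdq_ge`, Jordan), `fdq ≠ 0` there (`fdq_ne_zero`); the
  integral representation `fdq η q = (−iq)∫₀¹e^{−iηqs}ds` (`fdq_eq_integral`, Mathlib `integral_exp_mul_complex`) and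
  **(4.25) with constant 1**: `‖fdq η′ q − fdq η q‖ ≤ |η − η′|·q²` for all `0 < η, η′` and all real `q`
  (`norm_fdq_sub_fdq_le`; from `|e^{ia} − e^{ib}| ≤ |a − b|`, `norm_exp_I_sub_exp_I_le`).  King splits into real and
  imaginary parts and bounds each by `C|p′+l|²L^{−k}` using the zone; the integral route needs no zone condition here.
* §2 one factor `uFac η x = (e^{−ix} − 1)/fdq η x` (filled by `1` at `x = 0`): the exact relative-error identity
  `uFac η x − uFac η′ x = uFac η x · (fdq η′ x − fdq η x)/fdq η′ x` (`uFac_sub_uFac`), hence on the zones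
  `|ηx|, |η′x| ≤ π`: `‖uFac η x − uFac η′ x‖ ≤ (π/2)|η − η′||x|·‖uFac η x‖` (`norm_uFac_sub_uFac_le`) and the
  comparability `‖uFac η′ x‖ ≤ (π/2)‖uFac η x‖` (`norm_uFac_le_mul`).
* §3 King's "repeated use of the identity xy − zw = …" as a telescoping lemma with relative errors
  (`norm_prod_sub_prod_le_rel`): `‖a_i − b_i‖ ≤ ε_i‖a_i‖`, `‖b_i‖ ≤ K‖a_i‖`, `K ≥ 1` ⇒
  `‖Π a − Π b‖ ≤ K^{|s|}(Σε_i)Π‖a_i‖`.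
* §4 `uWeight η p = Π_μ uFac η (p_μ)` = (4.3) and **Lemma 4.4** (`lemma44`): for `0 < η, η′` and `p` in both zones,
  `‖u^η(p) − u^{η′}(p)‖ ≤ (π/2)^d·((π/2)|η − η′|Σ_μ|p_μ|)·‖u^η(p)‖`; in King's scaling `η = L^{−k}`, `η′ = L^{−(k+n)}`,
  zone `|p_μ| ≤ πL^k` (`lemma44_scaling`): `‖u_k − u_{k+n}‖ ≤ (π/2)^{d+1}·L^{−k}·(Σ_μ|p_μ|)·‖u_k‖` — (4.29) with
  `γ = 1` and `C = (π/2)^{d+1}` (for `Σ_μ|p_μ|` in place of `|p|`).  The printed `γ < 1` versions are weaker on the zone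
  (`L^{−k}|p_μ| ≤ π` ⇒ `L^{−k}|p| ≤ (L^{−k}|p|)^γ(√dπ)^{1−γ}`) and are not spelled out.

**NOT COVERED.**  The rest of the proof of Proposition 3.8 ((4.19)–(4.24), (4.26)–(4.28), (4.31): the Hölder/derivative
versions, the alias sums (4.22), and the assembly with Lemma 4.3 and (4.7)), Proposition 3.9 ((4.42)–(4.43)), and
anything at `A ≠ 0`.  This module supplies exactly the factor-replacement estimate for the averaging weight.

**How the cell uses this (pointer, not a ruling).**  TEMPLATE §18.2 K3: the printed η-rate mechanism for the LINEAR
minimizer kernel `ℋ_k = a_kG_kQ_k^*` is "replace factor by factor in the Fourier representation (4.2)"; the three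
factors are `u` (this module: rate `L^{−k}|p|`), `Δ^{(k)}` (`…/CompositionLaw.lemma43_aK`: rate `L^{−2k}`) and
`Δ^{η}(p′+l)^{−1}` ((4.7)/(4.31), `…/EffectiveLaplacianRate.latticeSymbol_inv_sub_ref_le`: rate `L^{−2k}`).  For
Bałaban's NON-linear minimizers `U_k(V)` (T4-DAG NE3) there is no factorised Fourier representation; nothing here
asserts anything about them.  No `def … : Prop` hypothesis is introduced.  Value = kernel reproduction of a printed
`A = 0` estimate with explicit constants, NOT summit progress.
-/

noncomputable section

open Complex Finset MeasureTheory intervalIntegral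

namespace Literature.MathematicalPhysics.QuantumFieldTheory.King1986

/-! ## §1 The fine-lattice difference symbol `η⁻¹(e^{−iηq} − 1)` and the rate (4.25) -/

/-- One coordinate of the denominator of (4.3): `D_η(q) := η⁻¹(e^{−iηq} − 1)` (the Fourier symbol of the backward
difference on the `η`-lattice). [cite: King1986, (4.3) p.670] -/
def fdq (η q : ℝ) : ℂ := (Complex.exp (I * ((-(η * q) : ℝ) : ℂ)) - 1) / (η : ℂ)

/-- `‖e^{ia} − e^{ib}‖ ≤ |a − b|` for real phases. [folklore] -/
theorem norm_exp_I_sub_exp_I_le (a b : ℝ) :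
    ‖Complex.exp (I * (a : ℂ)) - Complex.exp (I * (b : ℂ))‖ ≤ |a - b| := by
  have e : Complex.exp (I * (a : ℂ)) - Complex.exp (I * (b : ℂ))
      = Complex.exp (I * (b : ℂ)) * (Complex.exp (I * ((a - b : ℝ) : ℂ)) - 1) := by
    rw [mul_sub, mul_one, ← Complex.exp_add]
    push_cast
    ring_nf
  rw [e, norm_mul, Complex.norm_exp_I_mul_ofReal, one_mul]
  have := (Real.norm_exp_I_mul_ofReal_sub_one_le (x := a - b))
  simpa [Real.norm_eq_abs] using this

/-- `‖D_η(q)‖ ≤ |q|` for `η > 0` (`|e^{ix} − 1| ≤ |x|`). [folklore] -/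
theorem norm_fdq_le {η : ℝ} (hη : 0 < η) (q : ℝ) : ‖fdq η q‖ ≤ |q| := by
  unfold fdq
  rw [norm_div, Complex.norm_real, Real.norm_eq_abs, abs_of_pos hη, div_le_iff₀ hη]
  have h := (Real.norm_exp_I_mul_ofReal_sub_one_le (x := -(η * q)))
  rw [Real.norm_eq_abs, abs_neg, abs_mul, abs_of_pos hη] at h
  linarith [h]

/-- `‖D_η(q)‖ = 2η⁻¹|sin(ηq/2)| ≥ (2/π)|q|` on the zone `|ηq| ≤ π` (Jordan's inequality). [folklore] -/
theorem norm_fdq_ge {η : ℝ} (hη : 0 < η) {q : ℝ} (hq : |η * q| ≤ Real.pi) :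
    2 / Real.pi * |q| ≤ ‖fdq η q‖ := by
  unfold fdq
  rw [norm_div, Complex.norm_real, Real.norm_eq_abs, abs_of_pos hη, le_div_iff₀ hη,
    Complex.norm_exp_I_mul_ofReal_sub_one, Real.norm_eq_abs, abs_mul, abs_two]
  -- `|sin(t)| ≥ (2/π)|t|` for `|t| ≤ π/2`, `t = -(ηq)/2`
  have key : ∀ t : ℝ, |t| ≤ Real.pi / 2 → 2 / Real.pi * |t| ≤ |Real.sin t| := by
    intro t ht
    rcases le_or_gt 0 t with h0 | h0
    · rw [abs_of_nonneg h0] at ht ⊢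
      have := Real.mul_le_sin h0 ht
      exact this.trans (le_abs_self _)
    · have ht' : -t ≤ Real.pi / 2 := by rw [abs_of_neg h0] at ht; exact ht
      have := Real.mul_le_sin (neg_nonneg.mpr h0.le) ht'
      rw [Real.sin_neg] at this
      rw [abs_of_neg h0]
      exact this.trans (neg_le_abs _)
  have ht : |(-(η * q)) / 2| ≤ Real.pi / 2 := by
    rw [abs_div, abs_neg, abs_two]; linarith
  have h := key (-(η * q) / 2) ht
  rw [abs_div, abs_neg, abs_two, abs_mul, abs_of_pos hη] at h
  -- h : 2/π * (η * |q| / 2) ≤ |sin(-(η q)/2)|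
  calc 2 / Real.pi * |q| * η = 2 * (2 / Real.pi * (η * |q| / 2)) := by ring
    _ ≤ 2 * |Real.sin (-(η * q) / 2)| := by linarith

/-- `D_η(q) ≠ 0` for `q ≠ 0` on the zone. [folklore] -/
theorem fdq_ne_zero {η : ℝ} (hη : 0 < η) {q : ℝ} (hq0 : q ≠ 0) (hq : |η * q| ≤ Real.pi) :
    fdq η q ≠ 0 := by
  intro h
  have h1 := norm_fdq_ge hη hq
  rw [h, norm_zero] at h1
  have : 0 < 2 / Real.pi * |q| := by
    have := Real.pi_pos
    have := abs_pos.mpr hq0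
    positivity
  linarith

/-- Integral representation: for `η ≠ 0`, `q ≠ 0`, `D_η(q) = (−iq)·∫₀¹ e^{−iηqs} ds`. [folklore] -/
theorem fdq_eq_integral {η : ℝ} (hη : η ≠ 0) {q : ℝ} (hq : q ≠ 0) :
    fdq η q = (-(I * q)) * ∫ s in (0:ℝ)..1, Complex.exp ((I * ((-(η * q) : ℝ) : ℂ)) * s) := by
  have hc : (I * ((-(η * q) : ℝ) : ℂ)) ≠ 0 := by
    apply mul_ne_zero I_ne_zero
    exact_mod_cast (neg_ne_zero.mpr (mul_ne_zero hη hq))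
  rw [integral_exp_mul_complex hc]
  unfold fdq
  have hη' : (η : ℂ) ≠ 0 := by exact_mod_cast hη
  have hq' : (q : ℂ) ≠ 0 := by exact_mod_cast hq
  simp only [Complex.ofReal_one, mul_one, Complex.ofReal_zero, mul_zero, Complex.exp_zero]
  push_cast
  have hc' : I * -((η : ℂ) * q) ≠ 0 := by
    apply mul_ne_zero I_ne_zero
    exact neg_ne_zero.mpr (mul_ne_zero hη' hq')
  field_simp

/-- **(4.25) kernel.**  For `0 < η′`, `0 < η` and every real `q`:
`‖η′⁻¹(e^{−iη′q} − 1) − η⁻¹(e^{−iηq} − 1)‖ ≤ |η − η′|·q²` — King: *"≤ C|p′ + l|²L^{−k}"* with `η = L^{−k}`,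
`η′ = L^{−k−n}` (`|η − η′| ≤ η`).  Proof: both are `(−iq)∫₀¹e^{−i·(·)qs}ds` and `|e^{ia} − e^{ib}| ≤ |a − b|`.
[cite: King1986, (4.25) p.673] -/
theorem norm_fdq_sub_fdq_le {η η' : ℝ} (hη : 0 < η) (hη' : 0 < η') (q : ℝ) :
    ‖fdq η' q - fdq η q‖ ≤ |η - η'| * q ^ 2 := by
  rcases eq_or_ne q 0 with hq | hq
  · subst hq
    simp [fdq]
  rw [fdq_eq_integral hη'.ne' hq, fdq_eq_integral hη.ne' hq, ← mul_sub]
  have hint : ∀ θ : ℝ, IntervalIntegrable (fun s : ℝ => Complex.exp ((I * ((-(θ * q) : ℝ) : ℂ)) * s))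
      MeasureTheory.volume (0:ℝ) 1 := by
    intro θ
    apply Continuous.intervalIntegrable
    exact Complex.continuous_exp.comp (continuous_const.mul Complex.continuous_ofReal)
  rw [← intervalIntegral.integral_sub (hint η') (hint η), norm_mul]
  have hb : ∀ s ∈ Set.uIoc (0:ℝ) 1,
      ‖Complex.exp ((I * ((-(η' * q) : ℝ) : ℂ)) * s) - Complex.exp ((I * ((-(η * q) : ℝ) : ℂ)) * s)‖
        ≤ |η - η'| * |q| := by
    intro s hs
    rw [Set.uIoc_of_le zero_le_one] at hs
    have hs0 : 0 ≤ s := hs.1.le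
    have hs1 : s ≤ 1 := hs.2
    have e1 : (I * ((-(η' * q) : ℝ) : ℂ)) * s = I * (((-(η' * q) * s : ℝ)) : ℂ) := by push_cast; ring
    have e2 : (I * ((-(η * q) : ℝ) : ℂ)) * s = I * (((-(η * q) * s : ℝ)) : ℂ) := by push_cast; ring
    rw [e1, e2]
    refine (norm_exp_I_sub_exp_I_le _ _).trans ?_
    have : -(η' * q) * s - -(η * q) * s = (η - η') * q * s := by ring
    rw [this, abs_mul, abs_mul, abs_of_nonneg hs0]
    calc |η - η'| * |q| * s ≤ |η - η'| * |q| * 1 := by gcongr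
      _ = |η - η'| * |q| := mul_one _
  have hI := intervalIntegral.norm_integral_le_of_norm_le_const hb
  have hnq : ‖-(I * (q : ℂ))‖ = |q| := by simp
  rw [hnq]
  calc |q| * ‖∫ s in (0:ℝ)..1, (Complex.exp ((I * ((-(η' * q) : ℝ) : ℂ)) * s)
          - Complex.exp ((I * ((-(η * q) : ℝ) : ℂ)) * s))‖
      ≤ |q| * (|η - η'| * |q| * |1 - 0|) := mul_le_mul_of_nonneg_left hI (abs_nonneg q)
    _ = |η - η'| * q ^ 2 := by rw [sub_zero, abs_one, mul_one, ← sq_abs q]; ring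

/-! ## §2 One factor of `u_k^η(p)`: `(e^{−ip_μ} − 1)·η·(e^{−iηp_μ} − 1)⁻¹` -/

/-- One coordinate factor of King's averaging weight (4.3), `(e^{−ix} − 1)/D_η(x)`, with the removable
singularity at `x = 0` filled by its value `1`. [cite: King1986, (4.3) p.670] -/
def uFac (η x : ℝ) : ℂ := if x = 0 then 1 else (Complex.exp (I * ((-x : ℝ) : ℂ)) - 1) / fdq η x

/-- The two-spacing difference of one factor is the factor times a relative error:
`f_η − f_η′ = f_η·(D_η′ − D_η)/D_η′`. [folklore] -/
theorem uFac_sub_uFac {η η' x : ℝ} (hx : x ≠ 0) (hA : fdq η x ≠ 0) (hB : fdq η' x ≠ 0) :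
    uFac η x - uFac η' x = uFac η x * ((fdq η' x - fdq η x) / fdq η' x) := by
  unfold uFac
  simp only [hx, if_false]
  field_simp

/-- `(2/π)|x| ≤ ‖D_η′(x)‖` rewritten as `|x| ≤ (π/2)‖D_η′(x)‖`. [folklore] -/
theorem abs_le_mul_norm_fdq {η : ℝ} (hη : 0 < η) {x : ℝ} (hx : |η * x| ≤ Real.pi) :
    |x| ≤ Real.pi / 2 * ‖fdq η x‖ := by
  have h := mul_le_mul_of_nonneg_left (norm_fdq_ge hη hx) (by positivity : (0:ℝ) ≤ Real.pi / 2)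
  have hπ0 : Real.pi ≠ 0 := Real.pi_pos.ne'
  have e : Real.pi / 2 * (2 / Real.pi * |x|) = (Real.pi / Real.pi) * |x| := by ring
  rw [e, div_self hπ0, one_mul] at h
  exact h

/-- **Per-coordinate Lemma 4.4.**  For `0 < η′`, `0 < η` and `x` in both zones `|ηx| ≤ π`, `|η′x| ≤ π`:
`‖f_η(x) − f_η′(x)‖ ≤ (π/2)·|η − η′|·|x|·‖f_η(x)‖`. [cite: King1986, Lemma 4.4 (4.29)–(4.30) p.673] -/
theorem norm_uFac_sub_uFac_le {η η' x : ℝ} (hη : 0 < η) (hη' : 0 < η') (hxA : |η * x| ≤ Real.pi)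
    (hx : |η' * x| ≤ Real.pi) :
    ‖uFac η x - uFac η' x‖ ≤ Real.pi / 2 * |η - η'| * |x| * ‖uFac η x‖ := by
  rcases eq_or_ne x 0 with hx0 | hx0
  · subst hx0; simp [uFac]
  have hA : fdq η x ≠ 0 := fdq_ne_zero hη hx0 hxA
  have hB : fdq η' x ≠ 0 := fdq_ne_zero hη' hx0 hx
  rw [uFac_sub_uFac hx0 hA hB, norm_mul, norm_div]
  have hBpos : 0 < ‖fdq η' x‖ := norm_pos_iff.mpr hB
  have hnum : ‖fdq η' x - fdq η x‖ ≤ |η - η'| * x ^ 2 := norm_fdq_sub_fdq_le hη hη' x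
  have hxB : |x| ≤ Real.pi / 2 * ‖fdq η' x‖ := abs_le_mul_norm_fdq hη' hx
  have hquot : ‖fdq η' x - fdq η x‖ / ‖fdq η' x‖ ≤ Real.pi / 2 * |η - η'| * |x| := by
    rw [div_le_iff₀ hBpos]
    calc ‖fdq η' x - fdq η x‖ ≤ |η - η'| * x ^ 2 := hnum
      _ = |η - η'| * |x| * |x| := by rw [← sq_abs x]; ring
      _ ≤ |η - η'| * |x| * (Real.pi / 2 * ‖fdq η' x‖) :=
          mul_le_mul_of_nonneg_left hxB (mul_nonneg (abs_nonneg _) (abs_nonneg _))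
      _ = Real.pi / 2 * |η - η'| * |x| * ‖fdq η' x‖ := by ring
  calc ‖uFac η x‖ * (‖fdq η' x - fdq η x‖ / ‖fdq η' x‖)
      ≤ ‖uFac η x‖ * (Real.pi / 2 * |η - η'| * |x|) := mul_le_mul_of_nonneg_left hquot (norm_nonneg _)
    _ = Real.pi / 2 * |η - η'| * |x| * ‖uFac η x‖ := by ring

/-- The factors at two spacings are comparable: `‖f_η′(x)‖ ≤ (π/2)‖f_η(x)‖` when `0 < η`, `0 < η′`, `|ηx| ≤ π`,
`|η′x| ≤ π` (`‖D_η‖ ≤ |x| ≤ (π/2)‖D_η′‖`). [folklore] -/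
theorem norm_uFac_le_mul {η η' x : ℝ} (hη : 0 < η) (hη' : 0 < η') (hx : |η * x| ≤ Real.pi)
    (hx' : |η' * x| ≤ Real.pi) : ‖uFac η' x‖ ≤ Real.pi / 2 * ‖uFac η x‖ := by
  have hπ := Real.pi_pos
  rcases eq_or_ne x 0 with hx0 | hx0
  · subst hx0; simp [uFac]; linarith [Real.pi_gt_three]
  have hA : fdq η x ≠ 0 := fdq_ne_zero hη hx0 hx
  have hB : fdq η' x ≠ 0 := fdq_ne_zero hη' hx0 hx'
  unfold uFac
  simp only [hx0, if_false, norm_div]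
  have hApos : 0 < ‖fdq η x‖ := norm_pos_iff.mpr hA
  have hBpos : 0 < ‖fdq η' x‖ := norm_pos_iff.mpr hB
  have hAB : ‖fdq η x‖ ≤ Real.pi / 2 * ‖fdq η' x‖ := (norm_fdq_le hη x).trans (abs_le_mul_norm_fdq hη' hx')
  have hc : (Real.pi / 2 : ℝ) ≠ 0 := by positivity
  calc ‖Complex.exp (I * ((-x : ℝ) : ℂ)) - 1‖ / ‖fdq η' x‖
      = (Real.pi / 2 * ‖Complex.exp (I * ((-x : ℝ) : ℂ)) - 1‖) / (Real.pi / 2 * ‖fdq η' x‖) :=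
        (mul_div_mul_left _ _ hc).symm
    _ ≤ (Real.pi / 2 * ‖Complex.exp (I * ((-x : ℝ) : ℂ)) - 1‖) / ‖fdq η x‖ :=
        div_le_div_of_nonneg_left (by positivity) hApos hAB
    _ = Real.pi / 2 * (‖Complex.exp (I * ((-x : ℝ) : ℂ)) - 1‖ / ‖fdq η x‖) := mul_div_assoc _ _ _

/-! ## §3 "By repeated use of the identity xy − zw = …" — product telescoping with relative errors -/

/-- Telescoping for products: relative errors `‖a_i − b_i‖ ≤ ε_i‖a_i‖` and comparability `‖b_i‖ ≤ K‖a_i‖`, `K ≥ 1`,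
give `‖Π a − Π b‖ ≤ K^{|s|}·(Σ ε_i)·Π‖a_i‖`.  King (p.673): *"By repeated use of the identity xy − zw = 1/2(x − y)(z + w)
+ 1/2(x + y)(z − w), we can write the difference inside the last bracket of (4.30) as a sum of 2^{d−1} terms. Each term is
a product of d factors, at least one of which is the left-hand side of (4.25)."* [folklore] -/
theorem norm_prod_sub_prod_le_rel {ι : Type*} [DecidableEq ι] (s : Finset ι) (a b : ι → ℂ) (ε : ι → ℝ)
    {K : ℝ} (hK : 1 ≤ K) (hε : ∀ i ∈ s, 0 ≤ ε i) (hab : ∀ i ∈ s, ‖a i - b i‖ ≤ ε i * ‖a i‖)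
    (hb : ∀ i ∈ s, ‖b i‖ ≤ K * ‖a i‖) :
    ‖∏ i ∈ s, a i - ∏ i ∈ s, b i‖ ≤ K ^ s.card * (∑ i ∈ s, ε i) * ∏ i ∈ s, ‖a i‖ := by
  induction s using Finset.induction_on with
  | empty => simp
  | @insert j s hj ih =>
    have hε' : ∀ i ∈ s, 0 ≤ ε i := fun i hi => hε i (Finset.mem_insert_of_mem hi)
    have hab' : ∀ i ∈ s, ‖a i - b i‖ ≤ ε i * ‖a i‖ := fun i hi => hab i (Finset.mem_insert_of_mem hi)
    have hb' : ∀ i ∈ s, ‖b i‖ ≤ K * ‖a i‖ := fun i hi => hb i (Finset.mem_insert_of_mem hi)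
    have IH := ih hε' hab' hb'
    rw [Finset.prod_insert hj, Finset.prod_insert hj, Finset.prod_insert hj, Finset.sum_insert hj,
      Finset.card_insert_of_notMem hj]
    have hK0 : 0 ≤ K := by linarith
    have hPa : 0 ≤ ∏ i ∈ s, ‖a i‖ := Finset.prod_nonneg fun i _ => norm_nonneg _
    have hSε : 0 ≤ ∑ i ∈ s, ε i := Finset.sum_nonneg hε'
    have hεj : 0 ≤ ε j := hε j (Finset.mem_insert_self j s)
    have e : a j * ∏ i ∈ s, a i - b j * ∏ i ∈ s, b i
        = (a j - b j) * ∏ i ∈ s, a i + b j * (∏ i ∈ s, a i - ∏ i ∈ s, b i) := by ring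
    rw [e]
    have hnPa : ‖∏ i ∈ s, a i‖ = ∏ i ∈ s, ‖a i‖ := norm_prod _ _
    calc ‖(a j - b j) * ∏ i ∈ s, a i + b j * (∏ i ∈ s, a i - ∏ i ∈ s, b i)‖
        ≤ ‖(a j - b j) * ∏ i ∈ s, a i‖ + ‖b j * (∏ i ∈ s, a i - ∏ i ∈ s, b i)‖ := norm_add_le _ _
      _ = ‖a j - b j‖ * ∏ i ∈ s, ‖a i‖ + ‖b j‖ * ‖∏ i ∈ s, a i - ∏ i ∈ s, b i‖ := by
          rw [norm_mul, norm_mul, hnPa]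
      _ ≤ (ε j * ‖a j‖) * ∏ i ∈ s, ‖a i‖
          + (K * ‖a j‖) * (K ^ s.card * (∑ i ∈ s, ε i) * ∏ i ∈ s, ‖a i‖) :=
          add_le_add (mul_le_mul_of_nonneg_right (hab j (Finset.mem_insert_self j s)) hPa)
            (mul_le_mul (hb j (Finset.mem_insert_self j s)) IH (norm_nonneg _)
              (mul_nonneg hK0 (norm_nonneg _)))
      _ ≤ K ^ (s.card + 1) * (ε j + ∑ i ∈ s, ε i) * (‖a j‖ * ∏ i ∈ s, ‖a i‖) := by
          have h1 : ε j * ‖a j‖ * ∏ i ∈ s, ‖a i‖ ≤ K ^ (s.card + 1) * ε j * (‖a j‖ * ∏ i ∈ s, ‖a i‖) := by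
            have hK1 : 1 ≤ K ^ (s.card + 1) := one_le_pow₀ hK
            have h0 : 0 ≤ ε j * (‖a j‖ * ∏ i ∈ s, ‖a i‖) := mul_nonneg hεj (mul_nonneg (norm_nonneg _) hPa)
            nlinarith
          have h2 : K * ‖a j‖ * (K ^ s.card * (∑ i ∈ s, ε i) * ∏ i ∈ s, ‖a i‖)
              = K ^ (s.card + 1) * (∑ i ∈ s, ε i) * (‖a j‖ * ∏ i ∈ s, ‖a i‖) := by ring
          rw [h2]
          nlinarith [mul_nonneg (mul_nonneg (pow_nonneg hK0 (s.card + 1)) hSε)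
            (mul_nonneg (norm_nonneg (a j)) hPa)]

/-! ## §4 Lemma 4.4 assembled: `u_k^η(p) = Π_μ f_η(p_μ)` -/

/-- King's averaging weight (4.3), `u_k^η(p) = Π_{μ=1}^d [(e^{−ip_μ} − 1)η(e^{−iηp_μ} − 1)^{−1}]` (`η = L^{−k}`),
as a function of the spacing `η` and the momentum `p ∈ ℝ^d` (removable singularities filled). [cite: King1986, (4.3) p.670] -/
def uWeight {d : ℕ} (η : ℝ) (p : Fin d → ℝ) : ℂ := ∏ μ, uFac η (p μ)

/-- `‖u^η(p)‖ = Π_μ ‖f_η(p_μ)‖`. [folklore] -/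
theorem norm_uWeight {d : ℕ} (η : ℝ) (p : Fin d → ℝ) : ‖uWeight η p‖ = ∏ μ, ‖uFac η (p μ)‖ :=
  norm_prod _ _

/-- **Lemma 4.4 (4.29), `γ = 1` form with explicit constant.**  For two spacings `0 < η′`, `0 < η` and a momentum `p`
in the zone of the COARSER of the two fine lattices (`|ηp_μ| ≤ π` and `|η′p_μ| ≤ π` for all `μ`):
`‖u^η(p) − u^{η′}(p)‖ ≤ (π/2)^d · ((π/2)|η − η′| Σ_μ|p_μ|) · ‖u^η(p)‖`.
With `η = L^{−k}`, `η′ = L^{−k−n}` (`|η − η′| ≤ L^{−k}`) this is King's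
*"|u_k^η(p′+l) − u_{k+n}^{η′}(p′+l)| ≤ CL^{−γk}|p′+l|^γ|u_k^η(p′+l)|" (4.29)* at `γ = 1`; the printed `γ < 1` versions
follow on the zone from `η|p_μ| ≤ π`. [cite: King1986, Lemma 4.4 (4.29)–(4.30) p.673] -/
theorem lemma44 {d : ℕ} {η η' : ℝ} (hη : 0 < η) (hη' : 0 < η') {p : Fin d → ℝ}
    (hp : ∀ μ, |η * p μ| ≤ Real.pi) (hp' : ∀ μ, |η' * p μ| ≤ Real.pi) :
    ‖uWeight η p - uWeight η' p‖
      ≤ (Real.pi / 2) ^ d * (∑ μ, Real.pi / 2 * |η - η'| * |p μ|) * ‖uWeight η p‖ := by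
  unfold uWeight
  rw [norm_prod]
  have hK : (1 : ℝ) ≤ Real.pi / 2 := by linarith [Real.pi_gt_three]
  have h := norm_prod_sub_prod_le_rel (Finset.univ : Finset (Fin d)) (fun μ => uFac η (p μ))
    (fun μ => uFac η' (p μ)) (fun μ => Real.pi / 2 * |η - η'| * |p μ|) hK
    (fun μ _ => by positivity)
    (fun μ _ => norm_uFac_sub_uFac_le hη hη' (hp μ) (hp' μ))
    (fun μ _ => norm_uFac_le_mul hη hη' (hp μ) (hp' μ))
  simpa [Finset.card_univ, Fintype.card_fin] using h

/-- **(4.29) in King's scaling.**  `η = L^{−k}`, `η′ = L^{−(k+n)}`: `‖u_k − u_{k+n}‖ ≤ (π/2)^{d+1}·L^{−k}·(Σ_μ|p_μ|)·‖u_k‖`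
on the zone `|p_μ| ≤ πL^k`. [cite: King1986, Lemma 4.4 (4.29) p.673] -/
theorem lemma44_scaling {d L k n : ℕ} (hL : 2 ≤ L) {p : Fin d → ℝ}
    (hp : ∀ μ, |p μ| ≤ Real.pi * (L : ℝ) ^ k) :
    ‖uWeight (((L : ℝ) ^ k)⁻¹) p - uWeight (((L : ℝ) ^ (k + n))⁻¹) p‖
      ≤ (Real.pi / 2) ^ (d + 1) * ((L : ℝ) ^ k)⁻¹ * (∑ μ, |p μ|) * ‖uWeight (((L : ℝ) ^ k)⁻¹) p‖ := by
  have hL1 : (1 : ℝ) < L := by exact_mod_cast hL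
  have hLk : 0 < (L : ℝ) ^ k := pow_pos (by linarith) k
  have hLkn : 0 < (L : ℝ) ^ (k + n) := pow_pos (by linarith) (k + n)
  have hη : 0 < ((L : ℝ) ^ k)⁻¹ := inv_pos.mpr hLk
  have hη' : 0 < ((L : ℝ) ^ (k + n))⁻¹ := inv_pos.mpr hLkn
  have hle : ((L : ℝ) ^ (k + n))⁻¹ ≤ ((L : ℝ) ^ k)⁻¹ := by
    apply inv_anti₀ hLk
    rw [pow_add]
    exact le_mul_of_one_le_right hLk.le (one_le_pow₀ hL1.le)
  have hzone : ∀ μ, |((L : ℝ) ^ k)⁻¹ * p μ| ≤ Real.pi := by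
    intro μ
    rw [abs_mul, abs_of_pos hη, inv_mul_le_iff₀ hLk]
    calc |p μ| ≤ Real.pi * (L : ℝ) ^ k := hp μ
      _ = (L : ℝ) ^ k * Real.pi := mul_comm _ _
  have hzone' : ∀ μ, |((L : ℝ) ^ (k + n))⁻¹ * p μ| ≤ Real.pi := by
    intro μ
    rw [abs_mul, abs_of_pos hη']
    calc ((L : ℝ) ^ (k + n))⁻¹ * |p μ| ≤ ((L : ℝ) ^ k)⁻¹ * |p μ| :=
          mul_le_mul_of_nonneg_right hle (abs_nonneg _)
      _ = |((L : ℝ) ^ k)⁻¹ * p μ| := by rw [abs_mul, abs_of_pos hη]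
      _ ≤ Real.pi := hzone μ
  have h := lemma44 hη hη' hzone hzone'
  have hdiff : |((L : ℝ) ^ k)⁻¹ - ((L : ℝ) ^ (k + n))⁻¹| ≤ ((L : ℝ) ^ k)⁻¹ := by
    rw [abs_of_nonneg (by linarith)]
    linarith [hη'.le]
  have hsum : ∑ μ, Real.pi / 2 * |((L : ℝ) ^ k)⁻¹ - ((L : ℝ) ^ (k + n))⁻¹| * |p μ|
      ≤ ∑ μ, Real.pi / 2 * ((L : ℝ) ^ k)⁻¹ * |p μ| := by
    refine Finset.sum_le_sum fun μ _ => ?_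
    have hπ := Real.pi_pos
    have := abs_nonneg (p μ)
    gcongr
  have hU := norm_nonneg (uWeight (((L : ℝ) ^ k)⁻¹) p)
  have hπ2 : 0 ≤ (Real.pi / 2) ^ d := by positivity
  calc ‖uWeight (((L : ℝ) ^ k)⁻¹) p - uWeight (((L : ℝ) ^ (k + n))⁻¹) p‖
      ≤ (Real.pi / 2) ^ d * (∑ μ, Real.pi / 2 * |((L : ℝ) ^ k)⁻¹ - ((L : ℝ) ^ (k + n))⁻¹| * |p μ|)
          * ‖uWeight (((L : ℝ) ^ k)⁻¹) p‖ := h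
    _ ≤ (Real.pi / 2) ^ d * (∑ μ, Real.pi / 2 * ((L : ℝ) ^ k)⁻¹ * |p μ|)
          * ‖uWeight (((L : ℝ) ^ k)⁻¹) p‖ :=
        mul_le_mul_of_nonneg_right (mul_le_mul_of_nonneg_left hsum hπ2) hU
    _ = (Real.pi / 2) ^ (d + 1) * ((L : ℝ) ^ k)⁻¹ * (∑ μ, |p μ|) * ‖uWeight (((L : ℝ) ^ k)⁻¹) p‖ := by
        rw [← Finset.mul_sum, pow_succ]; ring

end Literature.MathematicalPhysics.QuantumFieldTheory.King1986

end
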